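import Literature.Barriers.CriticalPhenomena.LongRangeTrivialityOnZ3TorusRP
import Literature.Barriers.CriticalPhenomena.LongRangeTrivialityOnZ3InfraredBoundFourier
import Literature.Barriers.CriticalPhenomena.LongRangeTrivialityOnZ3LatticeSums
import Literature.Probability.LatticeModels.TorusZeroMode

/-!
# Panis's infrared bound for `J_{x,y} = C₀|x-y|₁^{-d-α}` by the torus route:
# DISCHARGE of `panis_infraredBound_algebraic` (Panis 2023, §3.6 / Proposition 3.8)

Sibling of `Literature/Barriers/CriticalPhenomena/LongRangeTrivialityOnZ3.lean` (barrier catalogue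
D-0021, sub-problem `Ising3DConformalLimit`), sequel of `LongRangeTrivialityOnZ3TorusRP.lean`. This file
proves `theorem panis_infraredBound_algebraic_holds : panis_infraredBound_algebraic`, the one named fact
on which the barrier `LongRangeTrivialityOnZ3` rested (`LongRangeTrivialityOnZ3.of_irb`), WITHOUT the
infinite-volume Fourier bound (Proposition 3.7) and WITHOUT the Aizenman–Barsky–Fernández finiteness of
the susceptibility below `β_c` that the printed proof of Proposition 3.8 invokes: everything is done on
the even tori `𝕋_N` and transferred to `ℤ^d` by Griffiths' comparison.

For `J = C₀|·|₁^{-d-α}` (`d ≥ 3`, `C₀, α > 0`, `α ≠ 2`), `a = α∧2`, `0 < β < β_c`, `L ≥ 1`: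

1. PARSEVAL ON THE TORUS with multiplicities (`sum_sum_kernel_eq_fourier`,
   `sum_sum_box_kernel_eq_fourier`): `∑_{x,y∈Λ_L}G_N(x̄-ȳ) = N^{-d}∑_kŜ_N(k)‖∑_{x∈Λ_L}e^{iθ_k·x}‖²`,
   `G_N(z) = ⟨σ₀σ_z⟩_{𝕋_N,J^{(N)},β}`, `Ŝ_N(k) = ∑_zG_N(z)Re χ_k(z)`;
2. `k = 0`: `Ŝ_N(0)(2L+1)^{2d}` with `Ŝ_N(0) = ∑_zG_N(z) ≤ εN^d` for large even `N` because `m*(β) = 0`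
   below `β_c` (`torus_zeroMode_le_eventually`, `…TorusZeroMode.lean`); `k ≠ 0`:
   `Ŝ_N(k) ≤ ‖θ_k‖^{-a}/(β|J|c')` (`torus_twoPointFourier_le_rpow`) and the Fejér envelope
   `‖∑_{Λ_L}e^{iθ·x}‖² ≤ (9π²)^dL^{2d}W(Lθ)` (`norm_sum_box_cexp_sq_le`, `…InfraredBoundFourier.lean`);
3. the RIEMANN SUM `N^{-d}∑_{k≠0}W(Lθ_k)‖θ_k‖^{-a} ≤ Γ_d^dL^{a-d}` (`riemannSum_le`, `Γ_d = 394+2/(1-a/d)`):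
   with `tᵢ = |θᵢ|∨2π/N ≤ ‖θ‖_∞` one has `W(Lθ)‖θ‖^{-a} ≤ ∏ᵢ(1∨L²tᵢ²)⁻¹tᵢ^{-a/d}` (`N ≥ 8L`), the sum
   factorises over coordinates, and the one-dimensional sum is bounded by folding `ℤ/Nℤ` onto
   `[0,N/2]`, splitting at `⌊N/(7L)⌋` and the `p`-series bounds of `…LatticeSums.lean`
   (`riemannSum_one_dim_le`; purely discrete, no integrals);
4. hence `∑_{x,y∈Λ_L}G_N(x̄-ȳ) ≤ N^{-d}Ŝ_N(0)(2L+1)^{2d} + K L^{d+a}/β` (`torus_sum_sum_box_le`), and by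
   Griffiths' comparison of finite sums of free correlations with the torus
   (`sum_sum_pairCorrelation_le_of_torus`, from `expectIn_box_spinProduct_le_torusExpect`) and `N → ∞`,
   **`∑_{x,y∈Λ_L}S_β(x-y) ≤ KL^{d+a}/β`** (`sum_sum_pairCorrelation_le_torusRoute`);
5. the `x`-space step of the printed proof of Proposition 3.8 (MMS2 averaged, the tree's
   `panis_mms_two_point_monotone_holds`; `|Λ_{n/2}|χ_{n/2} ≤ ∑_{Λ_n²}S`) and left-continuity at `β_c` give
   **`panis_infraredBound_algebraic_beta_holds`**, and monotonicity in `β`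
   (`panis_infraredBound_algebraic_of_beta`) gives **`panis_infraredBound_algebraic_holds`**.

Not here: the barrier theorem `LongRangeTrivialityOnZ3_holds` (next file, one line from
`LongRangeTrivialityOnZ3.of_irb`).

## References

* R. Panis, arXiv:2309.05797 (2023) = Ann. Probab. 54 (2026), §3.3 (Prop. 3.4, Remark 3.5, Prop. 3.7,
  Prop. 3.8 and its proof, the display for algebraic decay interactions), §3.6 [Panis2023Triviality]
  (held; pp. 13–16 read).
* M. Aizenman, H. Duminil-Copin, V. Sidoravicius, CMP 334 (2015), §3.3 ((3.17), (3.19): zero mode and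
  free ≤ torus) [AizenmanDuminilCopinSidoraviciusCMP2015].
* J. Fröhlich, B. Simon, T. Spencer, CMP 50 (1976), §3 (the Fourier-space quadratic form)
  [FrohlichSimonSpencer1976].
-/

noncomputable section

namespace Literature.Barriers.CriticalPhenomena

open Literature.Probability.LatticeModels Literature.Probability.Percolation Filter Topology Finset
open _root_.MeasureTheory _root_.Set
open scoped symmDiff

namespace LongRangeIsing

/-! ### Parseval on the torus for a translation-invariant kernel sampled at a finite family of sites -/

section TorusParseval

variable {d N : ℕ} [NeZero N]

/-- Sums over a finite family of torus sites through the multiplicity function. [folklore] -/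
theorem sum_card_filter_mul {X : Type*} [DecidableEq X] (S : Finset X) (φ : X → TorusSite d N)
    {R : Type*} [CommRing R] (f : TorusSite d N → R) :
    ∑ a, (#(S.filter fun x => φ x = a) : R) * f a = ∑ x ∈ S, f (φ x) := by
  rw [← Finset.sum_fiberwise S φ (fun x => f (φ x))]
  refine Finset.sum_congr rfl fun a _ => ?_
  rw [Finset.sum_congr rfl (fun x hx => by rw [(Finset.mem_filter.1 hx).2] : ∀ x ∈ S.filter (fun x => φ x = a), f (φ x) = f a),
    Finset.sum_const, nsmul_eq_mul]

/-- **The quadratic form of a torus kernel at a finite family of sites, in Fourier variables**: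
`∑_{x,y∈S} G(φx - φy) = N^{-d}∑_k (∑_z G(z)Re χ_k(z)) ‖∑_{x∈S} conj χ_k(φx)‖²` for real `G`
(Parseval with the multiplicity function of `φ(S)`). [cite: FrohlichSimonSpencer1976, §3] -/
theorem sum_sum_kernel_eq_fourier (G : TorusSite d N → ℝ) {X : Type*} [DecidableEq X] (S : Finset X)
    (φ : X → TorusSite d N) :
    ∑ x ∈ S, ∑ y ∈ S, G (φ x - φ y) =
      ((N : ℝ) ^ d)⁻¹ * ∑ k, (∑ z, G z * (torusChar k z).re) *
        ‖∑ x ∈ S, (starRingEnd ℂ) (torusChar k (φ x))‖ ^ 2 := by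
  classical
  set r : TorusSite d N → ℝ := fun a => (#(S.filter fun x => φ x = a) : ℝ) with hr
  have h := sum_sum_mul_torusFourierInv_re (torusFourier fun z => (G z : ℂ)) r
  have hinv : torusFourierInv (torusFourier fun z => (G z : ℂ)) = fun z => (G z : ℂ) :=
    torusFourier_inversion_holds (fun z => (G z : ℂ))
  rw [hinv] at h
  simp only [Complex.ofReal_re] at h
  -- left-hand side: expand the multiplicities
  have hL : ∑ a, ∑ b, r a * r b * G (a - b) = ∑ x ∈ S, ∑ y ∈ S, G (φ x - φ y) := by
    calc ∑ a, ∑ b, r a * r b * G (a - b) = ∑ a, r a * ∑ b, r b * G (a - b) := by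
          refine Finset.sum_congr rfl fun a _ => ?_
          rw [Finset.mul_sum]
          exact Finset.sum_congr rfl fun b _ => by ring
      _ = ∑ a, r a * ∑ y ∈ S, G (a - φ y) := by
          refine Finset.sum_congr rfl fun a _ => ?_
          rw [sum_card_filter_mul S φ (fun b => G (a - b))]
      _ = ∑ x ∈ S, ∑ y ∈ S, G (φ x - φ y) := sum_card_filter_mul S φ (fun a => ∑ y ∈ S, G (a - φ y))
  -- right-hand side: the Fourier transform of the multiplicities and of `G`
  have hF : ∀ k, torusFourier (fun a => (r a : ℂ)) k = ∑ x ∈ S, (starRingEnd ℂ) (torusChar k (φ x)) := by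
    intro k
    rw [torusFourier_eq_sum_torusChar]
    have := sum_card_filter_mul S φ (R := ℂ) (fun a => (starRingEnd ℂ) (torusChar k a))
    simpa [hr] using this
  have hG : ∀ k, (torusFourier (fun z => (G z : ℂ)) k).re = ∑ z, G z * (torusChar k z).re := by
    intro k
    rw [torusFourier_eq_sum_torusChar, Complex.re_sum]
    refine Finset.sum_congr rfl fun z _ => ?_
    rw [Complex.re_ofReal_mul, Complex.conj_re]
  rw [hL] at h
  simp_rw [hF, hG] at h
  exact h

/-- **Parseval for the box on the torus**: for `G` real on `𝕋_N` and `L ∈ ℕ`,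
`∑_{x,y∈Λ_L} G(x̄ - ȳ) = N^{-d}∑_k (∑_zG(z)Re χ_k(z)) ‖∑_{x∈Λ_L}e^{iθ_k·x}‖²`.
[cite: Panis2023Triviality, proof of Proposition 3.8 (χ̃_L(β) = L^d∫ e^{-L²‖p‖²}Ŝ(p)dp, torus version)] -/
theorem sum_sum_box_kernel_eq_fourier (G : TorusSite d N → ℝ) (L : ℕ) :
    ∑ x ∈ box d L, ∑ y ∈ box d L, G (Torus.proj N x - Torus.proj N y) =
      ((N : ℝ) ^ d)⁻¹ * ∑ k, (∑ z, G z * (torusChar k z).re) *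
        ‖∑ x ∈ box d L, Complex.exp (Complex.I * (phase (centeredMomentum N k) x : ℂ))‖ ^ 2 := by
  rw [sum_sum_kernel_eq_fourier G (box d L) (Torus.proj N)]
  congr 1
  refine Finset.sum_congr rfl fun k _ => ?_
  congr 1
  rw [← Complex.norm_conj]
  rw [map_sum]
  congr 2
  refine Finset.sum_congr rfl fun x _ => ?_
  rw [Complex.conj_conj, torusChar_proj]

end TorusParseval


/-! ### The Riemann sum of the Fejér-weighted infrared majorant over the nonzero torus momenta -/

section RiemannSum

variable {N : ℕ}

/-- **Folding `ℤ/Nℤ` onto `[0, N/2]`**: for `F ≥ 0`, `∑_{κ∈ℤ/Nℤ} F(|centeredRep κ|) ≤ 2∑_{m=0}^{N/2} F(m)`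
(each `m` has at most the two preimages `±m`). [folklore] -/
theorem sum_zmod_natAbs_centeredRep_le [NeZero N] (F : ℕ → ℝ) (hF : ∀ m, 0 ≤ F m) :
    ∑ κ : ZMod N, F (centeredRep N κ).natAbs ≤ 2 * ∑ m ∈ Finset.range (N / 2 + 1), F m := by
  have h0 : ∑ κ : ZMod N, F (centeredRep N κ).natAbs =
      ∑ v ∈ Finset.range N, F (if 2 * v ≤ N then (v : ℤ) else (v : ℤ) - N).natAbs :=
    sum_zmod_val_eq_sum_range (N := N) (fun v => F (if 2 * v ≤ N then (v : ℤ) else (v : ℤ) - N).natAbs)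
  rw [h0, ← Finset.sum_filter_add_sum_filter_not (Finset.range N) (fun v => 2 * v ≤ N), two_mul]
  refine add_le_add ?_ ?_
  · calc ∑ v ∈ (Finset.range N).filter (fun v => 2 * v ≤ N), F (if 2 * v ≤ N then (v : ℤ) else (v : ℤ) - N).natAbs
        = ∑ v ∈ (Finset.range N).filter (fun v => 2 * v ≤ N), F v := by
          refine Finset.sum_congr rfl fun v hv => ?_
          rw [if_pos (Finset.mem_filter.1 hv).2, Int.natAbs_natCast]
      _ ≤ ∑ m ∈ Finset.range (N / 2 + 1), F m := by
          refine Finset.sum_le_sum_of_subset_of_nonneg (fun v hv => ?_) fun m _ _ => hF m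
          have h := (Finset.mem_filter.1 hv).2
          rw [Finset.mem_range]
          omega
  · calc ∑ v ∈ (Finset.range N).filter (fun v => ¬2 * v ≤ N), F (if 2 * v ≤ N then (v : ℤ) else (v : ℤ) - N).natAbs
        = ∑ v ∈ (Finset.range N).filter (fun v => ¬2 * v ≤ N), F (N - v) := by
          refine Finset.sum_congr rfl fun v hv => ?_
          obtain ⟨hv1, hv2⟩ := Finset.mem_filter.1 hv
          rw [Finset.mem_range] at hv1
          rw [if_neg hv2]
          congr 1
          omega
      _ = ∑ u ∈ ((Finset.range N).filter (fun v => ¬2 * v ≤ N)).image (fun v => N - v), F u := by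
          rw [Finset.sum_image]
          intro v hv w hw h
          have hv1 := Finset.mem_range.1 (Finset.mem_filter.1 hv).1
          have hw1 := Finset.mem_range.1 (Finset.mem_filter.1 hw).1
          simp only at h
          omega
      _ ≤ ∑ m ∈ Finset.range (N / 2 + 1), F m := by
          refine Finset.sum_le_sum_of_subset_of_nonneg (fun u hu => ?_) fun m _ _ => hF m
          obtain ⟨v, hv, rfl⟩ := Finset.mem_image.1 hu
          obtain ⟨hv1, hv2⟩ := Finset.mem_filter.1 hv
          rw [Finset.mem_range] at hv1 ⊢
          omega

/-- `⟨ϑ_κ⟩_N := |2π·centeredRep(κ)/N| ∨ 2π/N = (2π/N)(|centeredRep κ| ∨ 1)`. [folklore] -/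
theorem max_abs_centered_eq [NeZero N] (κ : ZMod N) :
    max |2 * Real.pi * (centeredRep N κ : ℝ) / N| (2 * Real.pi / N) =
      2 * Real.pi / N * ((max (centeredRep N κ).natAbs 1 : ℕ) : ℝ) := by
  have hN : (0 : ℝ) < N := by exact_mod_cast Nat.pos_of_ne_zero (NeZero.ne N)
  have hc : (0 : ℝ) < 2 * Real.pi / N := by positivity
  rw [abs_div, abs_mul, abs_of_pos Real.two_pi_pos, abs_of_pos hN]
  have e : |(centeredRep N κ : ℝ)| = ((centeredRep N κ).natAbs : ℝ) := by
    rw [← Int.cast_abs, Nat.cast_natAbs]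
  rw [e, Nat.cast_max, Nat.cast_one, mul_max_of_nonneg _ _ hc.le, mul_one]
  congr 1
  ring

variable {L : ℕ} {b : ℝ}

/-- The two majorants of `ψ(u) = (1 ∨ L²u²)⁻¹u^{-b}` (`u > 0`): `ψ(u) ≤ u^{-b}` and
`ψ(u) ≤ L^{-2}u^{-(2+b)}`. [folklore] -/
theorem fejerWeight_le_rpow {u : ℝ} (hu : 0 < u) :
    (max 1 ((L : ℝ) ^ 2 * u ^ 2))⁻¹ * u ^ (-b) ≤ u ^ (-b) := by
  have h1 : (max 1 ((L : ℝ) ^ 2 * u ^ 2))⁻¹ ≤ 1 := inv_le_one_of_one_le₀ (le_max_left _ _)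
  exact (mul_le_of_le_one_left (Real.rpow_nonneg hu.le _) h1)

/-- `ψ(u) ≤ L^{-2}u^{-(2+b)}` for `u > 0`, `L ≥ 1`. [folklore] -/
theorem fejerWeight_le_rpow' (hL : 1 ≤ L) {u : ℝ} (hu : 0 < u) :
    (max 1 ((L : ℝ) ^ 2 * u ^ 2))⁻¹ * u ^ (-b) ≤ ((L : ℝ) ^ 2)⁻¹ * u ^ (-(2 + b)) := by
  have hL0 : (0 : ℝ) < L := by exact_mod_cast hL
  have hy : 0 < (L : ℝ) ^ 2 * u ^ 2 := by positivity
  have h1 : (max 1 ((L : ℝ) ^ 2 * u ^ 2))⁻¹ ≤ ((L : ℝ) ^ 2 * u ^ 2)⁻¹ :=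
    inv_anti₀ hy (le_max_right _ _)
  calc (max 1 ((L : ℝ) ^ 2 * u ^ 2))⁻¹ * u ^ (-b) ≤ ((L : ℝ) ^ 2 * u ^ 2)⁻¹ * u ^ (-b) :=
        mul_le_mul_of_nonneg_right h1 (Real.rpow_nonneg hu.le _)
    _ = ((L : ℝ) ^ 2)⁻¹ * u ^ (-(2 + b)) := by
        rw [mul_inv, mul_assoc]
        congr 1
        rw [neg_add, Real.rpow_add hu, Real.rpow_neg hu.le 2, Real.rpow_two]

/-- **The one-dimensional Riemann sum of the Fejér-weighted majorant**: for `0 < b < 1`, `L ≥ 1`,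
`N ≥ 14L`, with `ψ(u) = (1 ∨ L²u²)⁻¹u^{-b}` and `⟨ϑ_κ⟩_N = |ϑ_κ| ∨ 2π/N` (`ϑ_κ = 2π·centeredRep(κ)/N`),
`N⁻¹∑_{κ∈ℤ/Nℤ} ψ(⟨ϑ_κ⟩_N) ≤ (394 + 2/(1-b)) L^{b-1}`: fold onto `m ∈ [0,N/2]`, split at
`m₀ = ⌊N/(7L)⌋`, and use the `p`-series bounds `∑_{m≤m₀}m^{-b} ≤ m₀^{1-b}/(1-b)`,
`∑_{m>m₀}m^{-(2+b)} ≤ m₀^{-(1+b)}/(1+b)`. [folklore] -/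
theorem riemannSum_one_dim_le (hb0 : 0 < b) (hb1 : b < 1) (hL : 1 ≤ L) (hN : 14 * L ≤ N) :
    haveI : NeZero N := ⟨by omega⟩
    (N : ℝ)⁻¹ * ∑ κ : ZMod N,
        (max 1 ((L : ℝ) ^ 2 * (max |2 * Real.pi * (centeredRep N κ : ℝ) / N| (2 * Real.pi / N)) ^ 2))⁻¹ *
          (max |2 * Real.pi * (centeredRep N κ : ℝ) / N| (2 * Real.pi / N)) ^ (-b) ≤
      (394 + 2 / (1 - b)) * (L : ℝ) ^ (b - 1) := by
  haveI : NeZero N := ⟨by omega⟩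
  have hL0 : (0 : ℝ) < L := by exact_mod_cast hL
  have hN0 : (0 : ℝ) < N := by exact_mod_cast (show 0 < N by omega)
  have hLN : (L : ℝ) ≤ N := by exact_mod_cast (show L ≤ N by omega)
  have hπ := Real.pi_pos
  have hπ3 := Real.two_le_pi
  set c : ℝ := 2 * Real.pi / N with hc
  have hc0 : 0 < c := by positivity
  -- the summand as a function of `|centeredRep κ|`
  obtain ⟨ψ, hψ⟩ : ∃ ψ : ℝ → ℝ, ψ = fun u => (max 1 ((L : ℝ) ^ 2 * u ^ 2))⁻¹ * u ^ (-b) := ⟨_, rfl⟩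
  have hψ0 : ∀ u, 0 < u → 0 ≤ ψ u := fun u hu => by
    simp only [hψ]; exact mul_nonneg (inv_nonneg.2 (le_trans zero_le_one (le_max_left _ _))) (Real.rpow_nonneg hu.le _)
  obtain ⟨F, hF⟩ : ∃ F : ℕ → ℝ, F = fun m => ψ (c * ((max m 1 : ℕ) : ℝ)) := ⟨_, rfl⟩
  have hF0 : ∀ m, 0 ≤ F m := fun m => by rw [hF]; exact hψ0 _ (by positivity)
  have hsummand : ∀ κ : ZMod N,
      (max 1 ((L : ℝ) ^ 2 * (max |2 * Real.pi * (centeredRep N κ : ℝ) / N| c) ^ 2))⁻¹ *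
          (max |2 * Real.pi * (centeredRep N κ : ℝ) / N| c) ^ (-b) =
        F (centeredRep N κ).natAbs := by
    intro κ
    simp only [hF, hψ]
    rw [hc, max_abs_centered_eq κ]
  simp_rw [hsummand]
  -- fold
  have hfold := sum_zmod_natAbs_centeredRep_le (N := N) F hF0
  -- the folded sum: `m = 0` and `m ∈ [1, N/2]`
  set M : ℕ := N / 2 with hM
  have hsplit : ∑ m ∈ Finset.range (M + 1), F m = F 0 + ∑ m ∈ Finset.Ioc 0 M, ψ (c * m) := by
    have hI : Finset.Ico (0 + 1) (M + 1) = Finset.Ioc 0 M := by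
      ext m
      simp only [Finset.mem_Ico, Finset.mem_Ioc]
      omega
    rw [Finset.range_eq_Ico, Finset.sum_eq_sum_Ico_succ_bot (Nat.succ_pos M), hI]
    congr 1
    refine Finset.sum_congr rfl fun m hm => ?_
    have hm1 : 1 ≤ m := (Finset.mem_Ioc.1 hm).1
    simp only [hF, max_eq_left hm1]
  -- the splitting point
  set m₀ : ℕ := N / (7 * L) with hm₀
  have h7L : 0 < 7 * L := by omega
  have hm₀2 : 2 ≤ m₀ := by
    rw [hm₀, Nat.le_div_iff_mul_le h7L]; omega
  have hm₀1 : 1 ≤ m₀ := by omega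
  have hm₀M : m₀ ≤ M := by
    rw [hm₀, hM]
    exact Nat.div_le_div_left (by omega) (by omega)
  have hm₀r : (m₀ : ℝ) ≤ N / (7 * L) := by
    rw [le_div_iff₀ (by positivity)]
    have h1 : N / (7 * L) * (7 * L) ≤ N := Nat.div_mul_le_self N (7 * L)
    have h2 : ((N / (7 * L) * (7 * L) : ℕ) : ℝ) ≤ N := by exact_mod_cast h1
    rw [hm₀]
    push_cast at h2 ⊢
    linarith
  have hm₀r' : (N : ℝ) / (14 * L) ≤ m₀ := by
    have h1 : N < 7 * L * (m₀ + 1) := by rw [hm₀]; exact Nat.lt_mul_div_succ N h7L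
    have h2 : (N : ℝ) < 7 * L * (m₀ + 1) := by exact_mod_cast h1
    rw [div_le_iff₀ (by positivity)]
    have h3 : (2 : ℝ) ≤ m₀ := by exact_mod_cast hm₀2
    nlinarith
  have hm₀0 : (0 : ℝ) < m₀ := by exact_mod_cast hm₀1
  -- first block: `m ≤ m₀`, `ψ(cm) ≤ (cm)^{-b}`
  have hA : ∑ m ∈ Finset.Ioc 0 m₀, ψ (c * m) ≤ c ^ (-b) * ((m₀ : ℝ) ^ (1 - b) / (1 - b)) := by
    calc ∑ m ∈ Finset.Ioc 0 m₀, ψ (c * m) ≤ ∑ m ∈ Finset.Ioc 0 m₀, c ^ (-b) * (m : ℝ) ^ (-b) := by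
          refine Finset.sum_le_sum fun m hm => ?_
          have hm0 : (0 : ℝ) < m := by exact_mod_cast (Finset.mem_Ioc.1 hm).1
          simp only [hψ]
          refine (fejerWeight_le_rpow (L := L) (b := b) (by positivity)).trans (le_of_eq ?_)
          rw [Real.mul_rpow hc0.le hm0.le]
      _ = c ^ (-b) * ∑ m ∈ Finset.Icc 1 m₀, (m : ℝ) ^ (-b) := by
          rw [Finset.mul_sum]; rfl
      _ ≤ c ^ (-b) * ((m₀ : ℝ) ^ (1 - b) / (1 - b)) :=
          mul_le_mul_of_nonneg_left (sum_Icc_rpow_neg_le hb0.le hb1 hm₀1) (Real.rpow_nonneg hc0.le _)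
  -- second block: `m > m₀`, `ψ(cm) ≤ L^{-2}(cm)^{-(2+b)}`
  have hB : ∑ m ∈ Finset.Ioc m₀ M, ψ (c * m) ≤
      ((L : ℝ) ^ 2)⁻¹ * c ^ (-(2 + b)) * ((m₀ : ℝ) ^ (1 - (2 + b)) / ((2 + b) - 1)) := by
    calc ∑ m ∈ Finset.Ioc m₀ M, ψ (c * m)
        ≤ ∑ m ∈ Finset.Ioc m₀ M, ((L : ℝ) ^ 2)⁻¹ * c ^ (-(2 + b)) * (m : ℝ) ^ (-(2 + b)) := by
          refine Finset.sum_le_sum fun m hm => ?_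
          have hm0 : (0 : ℝ) < m := by
            have := (Finset.mem_Ioc.1 hm).1
            exact_mod_cast (show 0 < m by omega)
          simp only [hψ]
          refine (fejerWeight_le_rpow' (b := b) hL (by positivity)).trans (le_of_eq ?_)
          rw [Real.mul_rpow hc0.le hm0.le, mul_assoc]
      _ = ((L : ℝ) ^ 2)⁻¹ * c ^ (-(2 + b)) * ∑ m ∈ Finset.Ioc m₀ M, (m : ℝ) ^ (-(2 + b)) := by
          rw [Finset.mul_sum]
      _ ≤ ((L : ℝ) ^ 2)⁻¹ * c ^ (-(2 + b)) * ((m₀ : ℝ) ^ (1 - (2 + b)) / ((2 + b) - 1)) :=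
          mul_le_mul_of_nonneg_left (sum_Ioc_rpow_neg_le (by linarith) hm₀1 M) (by positivity)
  -- numerics: `c^{-b} ≤ N^b`, `c^{-(2+b)} ≤ N^{2+b}`, `m₀^{1-b} ≤ (N/L)^{1-b}`, `m₀^{-(1+b)} ≤ (14L/N)^{1+b}`
  have hcN : ∀ e : ℝ, 0 ≤ e → c ^ (-e) ≤ (N : ℝ) ^ e := by
    intro e he
    rw [Real.rpow_neg hc0.le, ← Real.inv_rpow hc0.le]
    refine Real.rpow_le_rpow (inv_nonneg.2 hc0.le) ?_ he
    rw [hc, inv_div, div_le_iff₀ (by positivity)]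
    nlinarith
  have h1b : 0 < 1 - b := by linarith
  have hm₀a : (m₀ : ℝ) ^ (1 - b) ≤ ((N : ℝ) / L) ^ (1 - b) := by
    refine Real.rpow_le_rpow hm₀0.le (hm₀r.trans ?_) h1b.le
    rw [div_le_div_iff_of_pos_left hN0 (by positivity) hL0]
    linarith
  have hm₀b : (m₀ : ℝ) ^ (1 - (2 + b)) ≤ ((14 * L : ℝ) / N) ^ (1 + b) := by
    have e1 : (1 - (2 + b)) = -(1 + b) := by ring
    rw [e1, Real.rpow_neg hm₀0.le, ← Real.inv_rpow hm₀0.le]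
    refine Real.rpow_le_rpow (inv_nonneg.2 hm₀0.le) ?_ (by linarith)
    rw [inv_le_comm₀ hm₀0 (by positivity), inv_div]
    exact hm₀r'
  -- assemble the three pieces
  have hT0 : (N : ℝ)⁻¹ * F 0 ≤ (L : ℝ) ^ (b - 1) := by
    have hF0' : F 0 = ψ c := by simp [hF]
    rw [hF0']
    calc (N : ℝ)⁻¹ * ψ c ≤ (N : ℝ)⁻¹ * c ^ (-b) :=
          mul_le_mul_of_nonneg_left (by rw [hψ]; exact fejerWeight_le_rpow hc0) (inv_nonneg.2 hN0.le)
      _ ≤ (N : ℝ)⁻¹ * (N : ℝ) ^ b := mul_le_mul_of_nonneg_left (hcN b hb0.le) (inv_nonneg.2 hN0.le)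
      _ = (N : ℝ) ^ (b - 1) := by
          rw [← Real.rpow_neg_one, ← Real.rpow_add hN0]; congr 1; ring
      _ ≤ (L : ℝ) ^ (b - 1) := Real.rpow_le_rpow_of_nonpos hL0 hLN (by linarith)
  have hT1 : (N : ℝ)⁻¹ * (c ^ (-b) * ((m₀ : ℝ) ^ (1 - b) / (1 - b))) ≤ (L : ℝ) ^ (b - 1) / (1 - b) := by
    calc (N : ℝ)⁻¹ * (c ^ (-b) * ((m₀ : ℝ) ^ (1 - b) / (1 - b)))
        ≤ (N : ℝ)⁻¹ * ((N : ℝ) ^ b * (((N : ℝ) / L) ^ (1 - b) / (1 - b))) :=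
          mul_le_mul_of_nonneg_left (mul_le_mul (hcN b hb0.le) (div_le_div_of_nonneg_right hm₀a h1b.le)
            (by positivity) (by positivity)) (inv_nonneg.2 hN0.le)
      _ = (L : ℝ) ^ (b - 1) / (1 - b) := by
          rw [Real.div_rpow hN0.le hL0.le, ← Real.rpow_neg_one]
          have e1 : (L : ℝ) ^ (b - 1) = ((L : ℝ) ^ (1 - b))⁻¹ := by
            rw [← Real.rpow_neg hL0.le]; congr 1; ring
          rw [e1]
          have e2 : (N : ℝ) ^ (-1 : ℝ) * ((N : ℝ) ^ b * ((N : ℝ) ^ (1 - b))) = 1 := by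
            rw [← Real.rpow_add hN0, ← Real.rpow_add hN0]
            have : (-1 : ℝ) + (b + (1 - b)) = 0 := by ring
            rw [this, Real.rpow_zero]
          have hL1b : (L : ℝ) ^ (1 - b) ≠ 0 := (Real.rpow_pos_of_pos hL0 _).ne'
          field_simp
          linear_combination e2
  have hT2 : (N : ℝ)⁻¹ * (((L : ℝ) ^ 2)⁻¹ * c ^ (-(2 + b)) * ((m₀ : ℝ) ^ (1 - (2 + b)) / ((2 + b) - 1))) ≤
      196 * (L : ℝ) ^ (b - 1) := by
    have h196 : ((14 * L : ℝ) / N) ^ (1 + b) ≤ 196 * ((L : ℝ) / N) ^ (1 + b) := by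
      rw [show (14 * L : ℝ) / N = 14 * ((L : ℝ) / N) by ring, Real.mul_rpow (by norm_num) (by positivity)]
      refine mul_le_mul_of_nonneg_right ?_ (Real.rpow_nonneg (by positivity) _)
      calc (14 : ℝ) ^ (1 + b) ≤ (14 : ℝ) ^ (2 : ℝ) := Real.rpow_le_rpow_of_exponent_le (by norm_num) (by linarith)
        _ = 196 := by norm_num
    have hden : (1 : ℝ) ≤ (2 + b) - 1 := by linarith
    calc (N : ℝ)⁻¹ * (((L : ℝ) ^ 2)⁻¹ * c ^ (-(2 + b)) * ((m₀ : ℝ) ^ (1 - (2 + b)) / ((2 + b) - 1)))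
        ≤ (N : ℝ)⁻¹ * (((L : ℝ) ^ 2)⁻¹ * (N : ℝ) ^ (2 + b) * ((196 * ((L : ℝ) / N) ^ (1 + b)) / 1)) := by
          refine mul_le_mul_of_nonneg_left (mul_le_mul (mul_le_mul_of_nonneg_left (hcN (2 + b) (by linarith))
            (by positivity)) (div_le_div₀ (by positivity) (hm₀b.trans h196) one_pos hden) (by positivity) (by positivity)) (inv_nonneg.2 hN0.le)
      _ = 196 * (L : ℝ) ^ (b - 1) := by
          rw [Real.div_rpow hL0.le hN0.le, div_one]
          have e1 : (L : ℝ) ^ (b - 1) = (L : ℝ) ^ (1 + b) * ((L : ℝ) ^ 2)⁻¹ := by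
            rw [← Real.rpow_two, ← Real.rpow_neg hL0.le, ← Real.rpow_add hL0]; congr 1; ring
          have e2 : (N : ℝ)⁻¹ * (N : ℝ) ^ (2 + b) = (N : ℝ) ^ (1 + b) := by
            rw [← Real.rpow_neg_one, ← Real.rpow_add hN0]; congr 1; ring
          have e3 : (N : ℝ) ^ (2 + b) = (N : ℝ) ^ (1 + b) * N := by
            rw [← Real.rpow_add_one hN0.ne']; congr 1; ring
          have hN1b : (N : ℝ) ^ (1 + b) ≠ 0 := (Real.rpow_pos_of_pos hN0 _).ne'
          rw [e1]
          field_simp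
          linear_combination e3
  -- conclusion
  have hIoc : ∑ m ∈ Finset.Ioc 0 M, ψ (c * m) =
      ∑ m ∈ Finset.Ioc 0 m₀, ψ (c * m) + ∑ m ∈ Finset.Ioc m₀ M, ψ (c * m) :=
    (Finset.sum_Ioc_consecutive _ (Nat.zero_le m₀) hm₀M).symm
  calc (N : ℝ)⁻¹ * ∑ κ : ZMod N, F (centeredRep N κ).natAbs
      ≤ (N : ℝ)⁻¹ * (2 * ∑ m ∈ Finset.range (M + 1), F m) :=
        mul_le_mul_of_nonneg_left hfold (inv_nonneg.2 hN0.le)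
    _ = 2 * ((N : ℝ)⁻¹ * F 0 + (N : ℝ)⁻¹ * ∑ m ∈ Finset.Ioc 0 m₀, ψ (c * m) +
          (N : ℝ)⁻¹ * ∑ m ∈ Finset.Ioc m₀ M, ψ (c * m)) := by
        rw [hsplit, hIoc]; ring
    _ ≤ 2 * ((L : ℝ) ^ (b - 1) + (L : ℝ) ^ (b - 1) / (1 - b) + 196 * (L : ℝ) ^ (b - 1)) :=
        mul_le_mul_of_nonneg_left (add_le_add (add_le_add hT0
          ((mul_le_mul_of_nonneg_left hA (inv_nonneg.2 hN0.le)).trans hT1))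
          ((mul_le_mul_of_nonneg_left hB (inv_nonneg.2 hN0.le)).trans hT2)) two_pos.le
    _ = (394 + 2 / (1 - b)) * (L : ℝ) ^ (b - 1) := by
        field_simp
        ring


variable {d : ℕ}

/-- **Termwise majorant**: for `k ≠ 0` and `N ≥ 8L`, with `θ = θ_k`, `tᵢ = |θᵢ| ∨ 2π/N`, `b = a/d`,
`W(Lθ)‖θ‖_∞^{-a} ≤ ∏ᵢ (1 ∨ L²tᵢ²)⁻¹tᵢ^{-b}` (`tᵢ ≤ ‖θ‖_∞`; a vanishing coordinate has `Ltᵢ ≤ 1`). [folklore] -/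
theorem envelope_mul_rpow_le_prod [NeZero N] (hd : 1 ≤ d) {a : ℝ} (ha0 : 0 ≤ a) (hL : 1 ≤ L) (hN : 8 * L ≤ N)
    {k : TorusSite d N} (hk : k ≠ 0) :
    envelope d ((L : ℝ) • centeredMomentum N k) * ‖centeredMomentum N k‖ ^ (-a) ≤
      ∏ i, (max 1 ((L : ℝ) ^ 2 * (max |centeredMomentum N k i| (2 * Real.pi / N)) ^ 2))⁻¹ *
        (max |centeredMomentum N k i| (2 * Real.pi / N)) ^ (-(a / d)) := by
  have hN0 : (0 : ℝ) < N := by exact_mod_cast (show 0 < N by omega)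
  have hL0 : (0 : ℝ) < L := by exact_mod_cast hL
  have hd0 : (0 : ℝ) < d := by exact_mod_cast hd
  set θ := centeredMomentum N k with hθ
  set t : Fin d → ℝ := fun i => max |θ i| (2 * Real.pi / N) with ht
  have hc0 : 0 < 2 * Real.pi / N := by positivity
  have ht0 : ∀ i, 0 < t i := fun i => lt_of_lt_of_le hc0 (le_max_right _ _)
  have htle : ∀ i, t i ≤ ‖θ‖ := fun i =>
    max_le ((Real.norm_eq_abs _).symm.le.trans (norm_le_pi_norm θ i)) (le_norm_centeredMomentum hk)
  have hθ0 : 0 < ‖θ‖ := norm_centeredMomentum_pos hk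
  -- `‖θ‖^{-a} ≤ ∏ tᵢ^{-b}`
  have h1 : ‖θ‖ ^ (-a) ≤ ∏ i, t i ^ (-(a / d)) := by
    have e : ‖θ‖ ^ (-a) = ∏ _i : Fin d, ‖θ‖ ^ (-(a / d)) := by
      rw [Finset.prod_const, Finset.card_univ, Fintype.card_fin, ← Real.rpow_natCast,
        ← Real.rpow_mul (norm_nonneg _)]
      congr 1
      field_simp
    rw [e]
    exact Finset.prod_le_prod (fun i _ => Real.rpow_nonneg (norm_nonneg _) _) fun i _ =>
      Real.rpow_le_rpow_of_nonpos (ht0 i) (htle i) (neg_nonpos.2 (by positivity))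
  -- `W(Lθ) ≤ ∏ (1 ∨ L²tᵢ²)⁻¹`
  have h2 : envelope d ((L : ℝ) • θ) ≤ ∏ i, (max 1 ((L : ℝ) ^ 2 * t i ^ 2))⁻¹ := by
    unfold envelope
    refine Finset.prod_le_prod (fun i _ => inv_nonneg.2 (le_trans zero_le_one (le_max_left _ _))) fun i _ => ?_
    refine inv_anti₀ (lt_of_lt_of_le zero_lt_one (le_max_left _ _)) ?_
    simp only [Pi.smul_apply, smul_eq_mul]
    by_cases hki : k i = 0
    · have hθi : θ i = 0 := (centeredMomentum_apply_eq_zero_iff k i).2 hki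
      have hti : t i = 2 * Real.pi / N := by simp [ht, hθi, hc0.le]
      rw [hθi, hti, mul_zero]
      refine le_trans (max_le le_rfl ?_) (le_max_left _ _)
      have hπ4 := Real.pi_le_four
      have h8 : 8 * (L : ℝ) ≤ N := by exact_mod_cast hN
      have hx : (L : ℝ) * (2 * Real.pi / N) ≤ 1 := by
        rw [mul_div_assoc', div_le_one hN0]; nlinarith
      have hx0 : 0 ≤ (L : ℝ) * (2 * Real.pi / N) := by positivity
      have e : (L : ℝ) ^ 2 * (2 * Real.pi / N) ^ 2 = ((L : ℝ) * (2 * Real.pi / N)) ^ 2 := by ring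
      rw [e]
      exact pow_le_one₀ hx0 hx
    · have hti : t i = |θ i| := max_eq_left (le_abs_centeredMomentum hki)
      rw [hti, mul_pow, sq_abs]
  calc envelope d ((L : ℝ) • θ) * ‖θ‖ ^ (-a)
      ≤ (∏ i, (max 1 ((L : ℝ) ^ 2 * t i ^ 2))⁻¹) * ∏ i, t i ^ (-(a / d)) :=
        mul_le_mul h2 h1 (Real.rpow_nonneg (norm_nonneg _) _)
          (Finset.prod_nonneg fun i _ => inv_nonneg.2 (le_trans zero_le_one (le_max_left _ _)))
    _ = ∏ i, (max 1 ((L : ℝ) ^ 2 * t i ^ 2))⁻¹ * t i ^ (-(a / d)) := by rw [Finset.prod_mul_distrib]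

/-- **The Riemann sum of the infrared majorant over the nonzero torus momenta**: for `0 < a < d`,
`L ≥ 1`, `N ≥ 14L`,
`N^{-d}∑_{k∈𝕋_N^*∖0} W(Lθ_k)‖θ_k‖_∞^{-a} ≤ (394 + 2/(1-a/d))^d L^{a-d}` — the momentum sum
factorises over coordinates after the termwise majorant, and each factor is the one-dimensional sum of
`riemannSum_one_dim_le`. This is the torus counterpart of `∫_{ℝ^d}W(u)‖u‖^{-a}du < ∞` (`a < d`) in the
printed proof of Proposition 3.8. [cite: Panis2023Triviality, proof of Proposition 3.8 (last paragraph)] -/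
theorem riemannSum_le (hd : 1 ≤ d) {a : ℝ} (ha0 : 0 < a) (had : a < d) (hL : 1 ≤ L) (hN : 14 * L ≤ N) :
    haveI : NeZero N := ⟨by omega⟩
    ((N : ℝ) ^ d)⁻¹ * ∑ k ∈ Finset.univ.erase (0 : TorusSite d N),
        envelope d ((L : ℝ) • centeredMomentum N k) * ‖centeredMomentum N k‖ ^ (-a) ≤
      (394 + 2 / (1 - a / d)) ^ d * (L : ℝ) ^ (a - d) := by
  haveI : NeZero N := ⟨by omega⟩
  have hN0 : (0 : ℝ) < N := by exact_mod_cast (show 0 < N by omega)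
  have hL0 : (0 : ℝ) < L := by exact_mod_cast hL
  have hd0 : (0 : ℝ) < d := by exact_mod_cast hd
  set b : ℝ := a / d with hb
  have hb0 : 0 < b := by positivity
  have hb1 : b < 1 := by rw [hb, div_lt_one hd0]; exact had
  -- the one-dimensional summand
  obtain ⟨g, hg⟩ : ∃ g : ZMod N → ℝ, g = fun κ =>
      (max 1 ((L : ℝ) ^ 2 * (max |2 * Real.pi * (centeredRep N κ : ℝ) / N| (2 * Real.pi / N)) ^ 2))⁻¹ *
        (max |2 * Real.pi * (centeredRep N κ : ℝ) / N| (2 * Real.pi / N)) ^ (-b) := ⟨_, rfl⟩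
  have hg0 : ∀ κ, 0 ≤ g κ := fun κ => by
    rw [hg]
    exact mul_nonneg (inv_nonneg.2 (le_trans zero_le_one (le_max_left _ _)))
      (Real.rpow_nonneg (le_trans (by positivity) (le_max_right _ _)) _)
  have h1d : (N : ℝ)⁻¹ * ∑ κ, g κ ≤ (394 + 2 / (1 - b)) * (L : ℝ) ^ (b - 1) := by
    have := riemannSum_one_dim_le hb0 hb1 hL hN
    simpa only [hg] using this
  -- termwise and factorisation
  have hterm : ∀ k ∈ Finset.univ.erase (0 : TorusSite d N),
      envelope d ((L : ℝ) • centeredMomentum N k) * ‖centeredMomentum N k‖ ^ (-a) ≤ ∏ i, g (k i) := by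
    intro k hk
    have hk0 : k ≠ 0 := Finset.ne_of_mem_erase hk
    refine (envelope_mul_rpow_le_prod hd ha0.le hL (by omega) hk0).trans (le_of_eq ?_)
    simp only [hg, centeredMomentum, hb]
  have hfac : ∑ k : TorusSite d N, ∏ i, g (k i) = (∑ κ, g κ) ^ d := by
    have h := Finset.prod_univ_sum (fun _ : Fin d => (Finset.univ : Finset (ZMod N))) (fun _ κ => g κ)
    rw [Fintype.piFinset_univ, Finset.prod_const, Finset.card_univ, Fintype.card_fin] at h
    exact h.symm
  have hsum : ∑ k ∈ Finset.univ.erase (0 : TorusSite d N),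
      envelope d ((L : ℝ) • centeredMomentum N k) * ‖centeredMomentum N k‖ ^ (-a) ≤ (∑ κ, g κ) ^ d := by
    calc ∑ k ∈ Finset.univ.erase (0 : TorusSite d N),
          envelope d ((L : ℝ) • centeredMomentum N k) * ‖centeredMomentum N k‖ ^ (-a)
        ≤ ∑ k ∈ Finset.univ.erase (0 : TorusSite d N), ∏ i, g (k i) := Finset.sum_le_sum hterm
      _ ≤ ∑ k : TorusSite d N, ∏ i, g (k i) :=
          Finset.sum_le_sum_of_subset_of_nonneg (Finset.erase_subset _ _) fun k _ _ =>
            Finset.prod_nonneg fun i _ => hg0 _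
      _ = (∑ κ, g κ) ^ d := hfac
  have hS0 : 0 ≤ (N : ℝ)⁻¹ * ∑ κ, g κ := mul_nonneg (inv_nonneg.2 hN0.le) (Finset.sum_nonneg fun κ _ => hg0 κ)
  calc ((N : ℝ) ^ d)⁻¹ * ∑ k ∈ Finset.univ.erase (0 : TorusSite d N),
        envelope d ((L : ℝ) • centeredMomentum N k) * ‖centeredMomentum N k‖ ^ (-a)
      ≤ ((N : ℝ) ^ d)⁻¹ * (∑ κ, g κ) ^ d := mul_le_mul_of_nonneg_left hsum (by positivity)
    _ = ((N : ℝ)⁻¹ * ∑ κ, g κ) ^ d := by rw [mul_pow, inv_pow]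
    _ ≤ ((394 + 2 / (1 - b)) * (L : ℝ) ^ (b - 1)) ^ d := pow_le_pow_left₀ hS0 h1d d
    _ = (394 + 2 / (1 - a / d)) ^ d * (L : ℝ) ^ (a - d) := by
        rw [mul_pow, ← hb]
        congr 1
        rw [← Real.rpow_natCast, ← Real.rpow_mul hL0.le]
        congr 1
        rw [hb]
        field_simp

end RiemannSum

/-! ### The Fejér-weighted double sum on the torus: zero mode plus infrared majorant -/

section TorusDoubleSum

variable {d N : ℕ} {C₀ α : ℝ}

/-- `θ_0 = 0`. [folklore] -/
@[simp] theorem centeredMomentum_zero [NeZero N] : centeredMomentum N (0 : TorusSite d N) = 0 := by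
  funext i
  simp [centeredMomentum, centeredRep]

/-- `0·x = 0`. [folklore] -/
theorem phase_zero (x : Site d) : phase (0 : Fin d → ℝ) x = 0 := by simp [phase]

/-- The box character sum at zero momentum is `|Λ_L| = (2L+1)^d`. [folklore] -/
theorem norm_sum_box_cexp_zero_sq (L : ℕ) :
    ‖∑ x ∈ box d L, Complex.exp (Complex.I * (phase (0 : Fin d → ℝ) x : ℂ))‖ ^ 2 = (((2 * L + 1 : ℕ) : ℝ) ^ d) ^ 2 := by
  simp_rw [phase_zero, Complex.ofReal_zero, mul_zero, Complex.exp_zero, Finset.sum_const, card_box, nsmul_one]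
  rw [Complex.norm_natCast]
  push_cast
  ring

/-- **The double sum of the torus two-point function over `Λ_L × Λ_L`: zero mode plus infrared part.**
For `J_{x,y} = C₀|x-y|₁^{-d-α}` (`d ≥ 3`, `C₀, α > 0`), a cube gap bound `1 - Ĵ(q) ≥ c'‖q‖^{α∧2}`,
`N` even with `N ≥ 14L ≥ 14`, `β > 0`, and `G_N(z) = ⟨σ₀σ_z⟩_{𝕋_N,J^{(N)},β}`:
`∑_{x,y∈Λ_L}G_N(x̄-ȳ) ≤ N^{-d}(∑_zG_N(z))(2L+1)^{2d} + (9π²)^dΓ_d^d/(|J|c') · L^{d+α∧2}/β`,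
`Γ_d = 394 + 2/(1-(α∧2)/d)` (Parseval, the torus infrared bound off the zero mode, the Fejér envelope,
and the Riemann-sum bound). [cite: Panis2023Triviality, proof of Proposition 3.8 (χ̃_L ≤ C₃L^d∫e^{-L²‖p‖²}Ŝ(p)dp and Proposition 3.7), torus version] -/
theorem torus_sum_sum_box_le (hd : 3 ≤ d) (hC₀ : 0 < C₀) (hα : 0 < α) {c' : ℝ} (hc' : 0 < c')
    (hglob : ∀ q : Fin d → ℝ, ‖q‖ ≤ Real.pi →
      c' * ‖q‖ ^ min α 2 ≤ 1 - couplingFourier (algebraicCoupling d C₀ α) q)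
    [NeZero N] (hNe : Even N) {L : ℕ} (hL : 1 ≤ L) (hNL : 14 * L ≤ N) {β : ℝ} (hβ : 0 < β) :
    ∑ x ∈ box d L, ∑ y ∈ box d L, torusExpect (torusCoupling (algebraicCoupling d C₀ α) N) β 0
        (fun σ => spinAt 0 σ * spinAt (Torus.proj N x - Torus.proj N y) σ) ≤
      ((N : ℝ) ^ d)⁻¹ * (∑ z, torusExpect (torusCoupling (algebraicCoupling d C₀ α) N) β 0
          (fun σ => spinAt 0 σ * spinAt z σ)) * ((((2 * L + 1 : ℕ) : ℝ) ^ d) ^ 2) +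
        (9 * Real.pi ^ 2) ^ d * (394 + 2 / (1 - min α 2 / d)) ^ d /
          (couplingNorm (algebraicCoupling d C₀ α) * c') * (L : ℝ) ^ ((d : ℝ) + min α 2) / β := by
  have hd1 : 1 ≤ d := by omega
  have hN4 : 4 ≤ N := by omega
  set J := algebraicCoupling d C₀ α with hJ
  set a : ℝ := min α 2 with ha
  have ha0 : 0 < a := lt_min hα two_pos
  have had : a < d := lt_of_le_of_lt (min_le_right α 2) (by exact_mod_cast (show 2 < d by omega))
  have hpos := couplingNorm_algebraic_pos hd1 hC₀ hα
  have hL0 : (0 : ℝ) < L := by exact_mod_cast hL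
  set G : TorusSite d N → ℝ := fun z => torusExpect (torusCoupling J N) β 0 (fun σ => spinAt 0 σ * spinAt z σ) with hG
  have hG0 : ∀ z, 0 ≤ G z := fun z => by
    simp only [hG]
    simp_rw [spinAt_mul_spinAt_eq_spinProduct]
    exact torusExpect_spinProduct_nonneg _ β 0 hβ.le le_rfl
      (torusCoupling_nonneg J N (algebraicCoupling_nonneg hC₀.le α)) _
  set θ : TorusSite d N → Fin d → ℝ := centeredMomentum N with hθ
  set B : TorusSite d N → ℝ := fun k => ‖∑ x ∈ box d L, Complex.exp (Complex.I * (phase (θ k) x : ℂ))‖ ^ 2 with hB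
  set S : TorusSite d N → ℝ := fun k => ∑ z, G z * (torusChar k z).re with hS
  -- Parseval
  have hpar : ∑ x ∈ box d L, ∑ y ∈ box d L, G (Torus.proj N x - Torus.proj N y) =
      ((N : ℝ) ^ d)⁻¹ * ∑ k, S k * B k := sum_sum_box_kernel_eq_fourier G L
  -- the zero mode
  have h0 : S 0 * B 0 = (∑ z, G z) * ((((2 * L + 1 : ℕ) : ℝ) ^ d) ^ 2) := by
    simp only [hS, hB, hθ, torusChar_zero_left, Complex.one_re, mul_one, centeredMomentum_zero]
    rw [norm_sum_box_cexp_zero_sq]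
  -- the nonzero momenta
  set U : ℝ := 1 / (β * couplingNorm J * c') with hU
  have hU0 : 0 ≤ U := by positivity
  have hk : ∀ k ∈ Finset.univ.erase (0 : TorusSite d N),
      S k * B k ≤ U * ((9 * Real.pi ^ 2) ^ d * (L : ℝ) ^ (2 * d)) * (envelope d ((L : ℝ) • θ k) * ‖θ k‖ ^ (-a)) := by
    intro k hk
    have hk0 : k ≠ 0 := Finset.ne_of_mem_erase hk
    have hSk : S k ≤ U * ‖θ k‖ ^ (-a) := torus_twoPointFourier_le_rpow hd1 hC₀ hα hNe hN4 hβ hc' hglob hk0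
    have hBk : B k ≤ (9 * Real.pi ^ 2) ^ d * (L : ℝ) ^ (2 * d) * envelope d ((L : ℝ) • θ k) :=
      norm_sum_box_cexp_sq_le hL (norm_centeredMomentum_le k)
    have hB0 : 0 ≤ B k := sq_nonneg _
    have hbound0 : 0 ≤ U * ‖θ k‖ ^ (-a) := mul_nonneg hU0 (Real.rpow_nonneg (norm_nonneg _) _)
    calc S k * B k ≤ (U * ‖θ k‖ ^ (-a)) * B k := mul_le_mul_of_nonneg_right hSk hB0
      _ ≤ (U * ‖θ k‖ ^ (-a)) * ((9 * Real.pi ^ 2) ^ d * (L : ℝ) ^ (2 * d) * envelope d ((L : ℝ) • θ k)) :=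
          mul_le_mul_of_nonneg_left hBk hbound0
      _ = U * ((9 * Real.pi ^ 2) ^ d * (L : ℝ) ^ (2 * d)) * (envelope d ((L : ℝ) • θ k) * ‖θ k‖ ^ (-a)) := by ring
  have hR := riemannSum_le hd1 ha0 had hL hNL
  -- assemble
  rw [hpar, ← Finset.add_sum_erase _ _ (Finset.mem_univ (0 : TorusSite d N)), mul_add, h0]
  refine add_le_add (le_of_eq (by ring)) ?_
  calc ((N : ℝ) ^ d)⁻¹ * ∑ k ∈ Finset.univ.erase (0 : TorusSite d N), S k * B k
      ≤ ((N : ℝ) ^ d)⁻¹ * ∑ k ∈ Finset.univ.erase (0 : TorusSite d N),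
          U * ((9 * Real.pi ^ 2) ^ d * (L : ℝ) ^ (2 * d)) * (envelope d ((L : ℝ) • θ k) * ‖θ k‖ ^ (-a)) :=
        mul_le_mul_of_nonneg_left (Finset.sum_le_sum hk) (by positivity)
    _ = U * ((9 * Real.pi ^ 2) ^ d * (L : ℝ) ^ (2 * d)) *
          (((N : ℝ) ^ d)⁻¹ * ∑ k ∈ Finset.univ.erase (0 : TorusSite d N), envelope d ((L : ℝ) • θ k) * ‖θ k‖ ^ (-a)) := by
        rw [← Finset.mul_sum]; ring
    _ ≤ U * ((9 * Real.pi ^ 2) ^ d * (L : ℝ) ^ (2 * d)) * ((394 + 2 / (1 - a / d)) ^ d * (L : ℝ) ^ (a - d)) :=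
        mul_le_mul_of_nonneg_left hR (by positivity)
    _ = (9 * Real.pi ^ 2) ^ d * (394 + 2 / (1 - a / d)) ^ d / (couplingNorm J * c') * (L : ℝ) ^ ((d : ℝ) + a) / β := by
        have e : (L : ℝ) ^ (2 * d) * (L : ℝ) ^ (a - d) = (L : ℝ) ^ ((d : ℝ) + a) := by
          rw [← Real.rpow_natCast, ← Real.rpow_add hL0]
          congr 1
          push_cast
          ring
        rw [hU]
        field_simp
        rw [← e]
        ring

end TorusDoubleSum

/-! ### Passage to `ℤ^d`: the free-state double sum below `β_c` -/

section InfiniteVolume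

variable {d : ℕ}

/-- A small nonzero vector has nonzero projection: `z ∈ Λ_m`, `z ≠ 0`, `m < N` imply `z̄ ≠ 0`. [folklore] -/
theorem proj_ne_zero_of_mem_box {m N : ℕ} (hmN : m < N) {z : Site d} (hz : z ∈ box d m) (hz0 : z ≠ 0) :
    Torus.proj N z ≠ 0 := by
  intro h
  apply hz0
  funext i
  have hi : ((z i : ℤ) : ZMod N) = 0 := by
    have := congr_fun h i
    simpa [Torus.proj] using this
  rw [ZMod.intCast_zmod_eq_zero_iff_dvd] at hi
  have hb := (mem_box.1 hz) i
  refine Int.eq_zero_of_abs_lt_dvd hi ?_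
  rw [abs_lt]
  constructor <;> omega

/-- The transported pair observable: for `z` with `z = 0 ↔ z̄ = 0`,
`σ_{proj({0}∆{z})} = σ₀σ_{z̄}` on the torus. [folklore] -/
theorem spinProduct_image_proj_pair (N : ℕ) {z : Site d} (hz : z ≠ 0 → Torus.proj N z ≠ 0) :
    spinProduct ((({0} : Finset (Site d)) ∆ {z}).image (Torus.proj N)) =
      fun σ => spinAt 0 σ * spinAt (Torus.proj N z) σ := by
  funext σ
  by_cases h0 : z = 0
  · subst h0
    simp [symmDiff_self]
  · have hz' := hz h0
    have h1 : (({0} : Finset (Site d)) ∆ {z}) = {0, z} := by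
      rw [Disjoint.symmDiff_eq_sup (Finset.disjoint_singleton.2 (Ne.symm h0))]
      rfl
    have h2 : (({0} : Finset (TorusSite d N)) ∆ {Torus.proj N z}) = {0, Torus.proj N z} := by
      rw [Disjoint.symmDiff_eq_sup (Finset.disjoint_singleton.2 (Ne.symm hz'))]
      rfl
    rw [spinAt_mul_spinAt_eq_spinProduct, h2, h1, Finset.image_insert, Finset.image_singleton]
    congr 2
    funext i; simp [Torus.proj]

variable (J : Site d → Site d → ℝ) (β : ℝ)

/-- **The free-state double sum is dominated by the torus double sums**: if for all even `M ≥ N₀`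
`∑_{x,y∈Λ_L}⟨σ₀σ_{x̄-ȳ}⟩_{𝕋_M,J^{(M)},β} ≤ B`, then `∑_{x,y∈Λ_L}S_β(x-y) ≤ B` (`β ≥ 0`, `J ≥ 0`
translation invariant with `J_{0,·}` summable): finite sums of Griffiths' comparison
`⟨σ_A⟩^free_{Λ_n} ≤ ⟨σ_Ā⟩_{𝕋_M}` (`2n+1 ≤ M`) and the box limit.
[cite: AizenmanDuminilCopinSidoraviciusCMP2015, §3.3 eq. (3.19)] -/
theorem sum_sum_pairCorrelation_le_of_torus (hβ : 0 ≤ β) (hJ : ∀ x y, 0 ≤ J x y)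
    (hJt : ∀ a x y, J (x + a) (y + a) = J x y) (hJs : Summable (J 0)) {L : ℕ} {B : ℝ} {N₀ : ℕ}
    (hB : ∀ M : ℕ, [NeZero M] → N₀ ≤ M → Even M →
      ∑ x ∈ box d L, ∑ y ∈ box d L, torusExpect (torusCoupling J M) β 0
        (fun σ => spinAt 0 σ * spinAt (Torus.proj M x - Torus.proj M y) σ) ≤ B) :
    ∑ x ∈ box d L, ∑ y ∈ box d L, pairCorrelation J β 0 (x - y) ≤ B := by
  have hlim : Tendsto (fun n : ℕ => ∑ x ∈ box d L, ∑ y ∈ box d L,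
      expectIn J (box d n) β 0 (spinProduct (({0} : Finset (Site d)) ∆ {x - y}))) atTop
      (𝓝 (∑ x ∈ box d L, ∑ y ∈ box d L, pairCorrelation J β 0 (x - y))) := by
    simp_rw [pairCorrelation_eq]
    exact tendsto_finsetSum _ fun x _ => tendsto_finsetSum _ fun y _ => tendsto_expectIn_box J β hβ hJ _
  refine le_of_tendsto hlim ?_
  filter_upwards [eventually_ge_atTop (2 * L)] with n hn
  set M : ℕ := 2 * max N₀ (n + 1) with hM
  haveI : NeZero M := ⟨by omega⟩
  have hnM : 2 * n + 1 ≤ M := by omega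
  have hsub : ∀ x ∈ box d L, ∀ y ∈ box d L, (({0} : Finset (Site d)) ∆ {x - y}) ⊆ box d n := by
    intro x hx y hy w hw
    rw [Finset.mem_symmDiff] at hw
    rcases hw with ⟨hw, -⟩ | ⟨hw, -⟩
    · rw [Finset.mem_singleton.1 hw]; exact zero_mem_box d n
    · rw [Finset.mem_singleton.1 hw]
      rw [mem_box] at hx hy ⊢
      intro i
      have := hx i; have := hy i
      simp only [Pi.sub_apply]
      constructor <;> omega
  have hproj : ∀ x ∈ box d L, ∀ y ∈ box d L, x - y ≠ 0 → Torus.proj M (x - y) ≠ 0 := by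
    intro x hx y hy hxy
    refine proj_ne_zero_of_mem_box (m := 2 * L) (by omega) ?_ hxy
    rw [mem_box] at hx hy ⊢
    intro i
    have := hx i; have := hy i
    simp only [Pi.sub_apply]
    constructor <;> push_cast <;> omega
  calc ∑ x ∈ box d L, ∑ y ∈ box d L, expectIn J (box d n) β 0 (spinProduct (({0} : Finset (Site d)) ∆ {x - y}))
      ≤ ∑ x ∈ box d L, ∑ y ∈ box d L, torusExpect (torusCoupling J M) β 0
          (spinProduct (((({0} : Finset (Site d)) ∆ {x - y})).image (Torus.proj M))) :=
        Finset.sum_le_sum fun x hx => Finset.sum_le_sum fun y hy =>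
          expectIn_box_spinProduct_le_torusExpect J M β 0 hβ le_rfl hJ hJt hJs hnM (hsub x hx y hy)
    _ = ∑ x ∈ box d L, ∑ y ∈ box d L, torusExpect (torusCoupling J M) β 0
          (fun σ => spinAt 0 σ * spinAt (Torus.proj M x - Torus.proj M y) σ) := by
        refine Finset.sum_congr rfl fun x hx => Finset.sum_congr rfl fun y hy => ?_
        rw [spinProduct_image_proj_pair M (hproj x hx y hy), torusProj_sub]
    _ ≤ B := hB M (by omega) ⟨max N₀ (n + 1), by omega⟩

variable {C₀ α : ℝ}

/-- **The Fejér-weighted double sum of the free two-point function below `β_c`** for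
`J_{x,y} = C₀|x-y|₁^{-d-α}` (`d ≥ 3`, `C₀, α > 0`, `α ≠ 2`): there is `K = K(d,C₀,α)` with
`∑_{x,y∈Λ_L} S_β(x-y) ≤ K L^{d+α∧2}/β` for all `0 < β < β_c` and `L ≥ 1`. Proof: on the even tori
`𝕋_N`, `N → ∞`, the zero mode is `o(N^d)` because `m*(β) = 0` below `β_c`
(`torus_zeroMode_le_eventually`), the rest is the infrared part of `torus_sum_sum_box_le`, and the
free state is dominated by the torus states. This replaces Proposition 3.7 (and the ABF input
`∑_xS_β(x) < ∞`) of the printed proof of Proposition 3.8.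
[cite: Panis2023Triviality, proof of Proposition 3.8 (χ̃_L(β) ≤ C₃L^d∫e^{-L²‖p‖²}Ŝ_β(p)dp and Proposition 3.7)] -/
theorem sum_sum_pairCorrelation_le_torusRoute (hd : 3 ≤ d) (hC₀ : 0 < C₀) (hα : 0 < α) (hα2 : α ≠ 2) :
    ∃ K : ℝ, 0 < K ∧ ∀ (β : ℝ), 0 < β → β < LongRangeIsing.criticalBeta (algebraicCoupling d C₀ α) →
      ∀ (L : ℕ), 1 ≤ L →
        ∑ x ∈ box d L, ∑ y ∈ box d L, pairCorrelation (algebraicCoupling d C₀ α) β 0 (x - y) ≤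
          K * (L : ℝ) ^ ((d : ℝ) + min α 2) / β := by
  have hd1 : 1 ≤ d := by omega
  set J := algebraicCoupling d C₀ α with hJ
  have hJt : ∀ a x y, J (x + a) (y + a) = J x y := algebraicCoupling_add C₀ α
  have hJnn : ∀ x y, 0 ≤ J x y := algebraicCoupling_nonneg hC₀.le α
  have hJs := algebraicCoupling_zero_summable hd1 hC₀.le hα
  have hpos := couplingNorm_algebraic_pos hd1 hC₀ hα
  obtain ⟨c', hc', hglob⟩ := exists_cube_gap_lower hd1 hC₀ hα hα2
  set K : ℝ := (9 * Real.pi ^ 2) ^ d * (394 + 2 / (1 - min α 2 / d)) ^ d / (couplingNorm J * c') with hK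
  have ha0 : 0 < min α 2 := lt_min hα two_pos
  have had : min α 2 / d < 1 := by
    rw [div_lt_one (by exact_mod_cast (show 0 < d by omega))]
    exact lt_of_le_of_lt (min_le_right α 2) (by exact_mod_cast (show 2 < d by omega))
  have hK0 : 0 < K := by
    have : 0 < 1 - min α 2 / d := by linarith
    positivity
  refine ⟨K, hK0, fun β hβ hβc L hL => ?_⟩
  have hm : magnetization J β = 0 := magnetization_eq_zero_of_lt_criticalBeta J β hβ hβc hJnn
  have hL0 : (0 : ℝ) < L := by exact_mod_cast hL
  refine le_of_forall_pos_le_add fun ε hε => ?_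
  -- the zero mode is eventually `≤ ε'N^d`, `ε' = ε/(2L+1)^{2d}`
  set V : ℝ := (((2 * L + 1 : ℕ) : ℝ) ^ d) ^ 2 with hV
  have hV0 : 0 < V := by positivity
  obtain ⟨N₀, hN₀⟩ := torus_zeroMode_le_eventually J β hd1 hβ hJnn hJt hJs hm (show 0 < ε / V by positivity)
  refine sum_sum_pairCorrelation_le_of_torus J β hβ.le hJnn hJt hJs (N₀ := max N₀ (14 * L)) fun M _ hM hMe => ?_
  have hM14 : 14 * L ≤ M := le_of_max_le_right hM
  have hMd : (0 : ℝ) < (M : ℝ) ^ d := by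
    have : (0 : ℝ) < M := by exact_mod_cast (show 0 < M by omega)
    positivity
  have hzero := hN₀ M (le_of_max_le_left hM)
  have hmain := torus_sum_sum_box_le hd hC₀ hα hc' hglob hMe hL hM14 hβ
  refine hmain.trans ?_
  rw [add_comm]
  refine add_le_add le_rfl ?_
  calc ((M : ℝ) ^ d)⁻¹ * (∑ z, torusExpect (torusCoupling J M) β 0 (fun σ => spinAt 0 σ * spinAt z σ)) * V
      ≤ ((M : ℝ) ^ d)⁻¹ * (ε / V * (M : ℝ) ^ d) * V :=
        mul_le_mul_of_nonneg_right (mul_le_mul_of_nonneg_left hzero (by positivity)) hV0.le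
    _ = ε := by field_simp

end InfiniteVolume

/-! ### The `x`-space infrared bound: discharge of `panis_infraredBound_algebraic_beta` and
### `panis_infraredBound_algebraic` -/

section XSpace

/-- `n ≤ 2⌊n/2⌋ + 1`, so `n^d ≤ |Λ_{⌊n/2⌋}|`. [folklore] -/
theorem pow_le_card_box_half' (d n : ℕ) : (n : ℝ) ^ d ≤ #(box d (n / 2)) := by
  rw [card_box]
  push_cast
  exact pow_le_pow_left₀ (Nat.cast_nonneg n) (by norm_cast; omega) d

end XSpace

end LongRangeIsing

open LongRangeIsing

/-- **DISCHARGE of `panis_infraredBound_algebraic_beta` (Panis 2023, §3.3, the infrared bound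
`⟨σ₀σ_x⟩_β ≤ C/(β|x|^{d-α∧2})` for `J_{x,y} = C₀|x-y|₁^{-d-α}`, `d ≥ 3`, `α ≠ 2`, `0 < β ≤ β_c`).**
Proof (torus route): for `x ≠ 0`, `n = |x|_∞`, MMS2 averaged over `Λ_{⌊n/d⌋}`
(`card_box_mul_pairCorrelation_le_boxSusceptibility`, with the tree's theorem
`panis_mms_two_point_monotone_holds`) and `|Λ_{⌊n/2⌋}|χ_{⌊n/2⌋} ≤ ∑_{Λ_n×Λ_n}S(x-y)` give
`n^d(n/d)^dS_β(x) ≤ ∑_{x,y∈Λ_n}S_β(x-y) ≤ Kn^{d+α∧2}/β` (`sum_sum_pairCorrelation_le_torusRoute`: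
reflection positivity and Gaussian domination on the even tori, the vanishing of the torus zero mode
below `β_c`, Griffiths' comparison free ≤ torus) for `β < β_c`; `β = β_c` by left-continuity
(`tendsto_pairCorrelation_nhdsLT`). No appeal to the uniqueness of the state or to the finiteness of
the susceptibility below `β_c`. [cite: Panis2023Triviality, §3.3 (display for algebraic decay interactions) and proof of Proposition 3.8] -/
theorem panis_infraredBound_algebraic_beta_holds : panis_infraredBound_algebraic_beta := by
  intro d hd C₀ α hC₀ hα hα2
  have hd1 : 1 ≤ d := by omega
  set J := algebraicCoupling d C₀ α with hJdef
  have hJnn : ∀ x y, 0 ≤ J x y := algebraicCoupling_nonneg hC₀.le α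
  obtain ⟨K, hK, hsum⟩ := sum_sum_pairCorrelation_le_torusRoute hd hC₀ hα hα2
  set a : ℝ := min α 2 with hadef
  set C : ℝ := K * (d : ℝ) ^ d with hCdef
  have hC : 0 < C := by positivity
  refine ⟨C, hC, fun β hβ hββc x hx => ?_⟩
  set n : ℕ := Site.supNorm x with hndef
  have hxn : ‖x‖ = n := Site.norm_eq_supNorm x
  have hn1 : 1 ≤ n := Nat.one_le_iff_ne_zero.2 fun h => hx (Site.supNorm_eq_zero_iff.1 h)
  have hn0 : (0 : ℝ) < n := by exact_mod_cast hn1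
  have hd0 : (0 : ℝ) < d := by exact_mod_cast hd1
  rw [hxn]
  -- the bound below `β_c`
  have hsub : ∀ β', 0 < β' → β' < LongRangeIsing.criticalBeta J →
      pairCorrelation J β' 0 x ≤ C / (β' * (n : ℝ) ^ ((d : ℝ) - a)) := by
    intro β' hβ' hβ'c
    have hmms : ∀ u v : Site d, (d : ℝ) * ‖u‖ ≤ ‖v‖ → pairCorrelation J β' 0 v ≤ pairCorrelation J β' 0 u :=
      panis_mms_two_point_monotone_holds d hd1 C₀ α hC₀ hα β' hβ'
    have h1 : (#(box d (n / d)) : ℝ) * pairCorrelation J β' 0 x ≤ boxSusceptibility J β' (n / d) :=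
      card_box_mul_pairCorrelation_le_boxSusceptibility J β' hmms (by rw [hndef]; exact Nat.mul_div_le _ d)
    have h2 : boxSusceptibility J β' (n / d) ≤ boxSusceptibility J β' (n / 2) :=
      boxSusceptibility_mono J β' hβ'.le hJnn (Nat.div_le_div_left (by omega) two_pos)
    have h3 : (#(box d (n / 2)) : ℝ) * boxSusceptibility J β' (n / 2) ≤
        ∑ u ∈ box d n, ∑ v ∈ box d n, pairCorrelation J β' 0 (u - v) :=
      card_box_mul_boxSusceptibility_le_sum_sum J β' hβ'.le hJnn (Nat.mul_div_le n 2 |> fun h => by omega)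
    have h4 := hsum β' hβ' hβ'c n hn1
    have hc1 : ((n : ℝ)) ^ d ≤ #(box d (n / 2)) := pow_le_card_box_half' d n
    have hc2 : ((n : ℝ) / d) ^ d ≤ #(box d (n / d)) := div_pow_le_card_box_div hd1 n
    have hcpos1 : (0 : ℝ) < #(box d (n / 2)) := lt_of_lt_of_le (by positivity) hc1
    have hS := pairCorrelation_nonneg J β' hβ'.le hJnn 0 x
    have h6 : (#(box d (n / 2)) : ℝ) * ((#(box d (n / d)) : ℝ) * pairCorrelation J β' 0 x) ≤
        K * (n : ℝ) ^ ((d : ℝ) + a) / β' :=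
      (mul_le_mul_of_nonneg_left (h1.trans h2) hcpos1.le).trans (h3.trans h4)
    have h7 : (n : ℝ) ^ d * (((n : ℝ) / d) ^ d * pairCorrelation J β' 0 x) ≤ K * (n : ℝ) ^ ((d : ℝ) + a) / β' := by
      refine le_trans ?_ h6
      exact mul_le_mul hc1 (mul_le_mul_of_nonneg_right hc2 hS) (by positivity) hcpos1.le
    have hnd : (0 : ℝ) < (n : ℝ) ^ d * ((n : ℝ) / d) ^ d := by positivity
    rw [← mul_assoc] at h7
    have h8 : pairCorrelation J β' 0 x ≤ K * (n : ℝ) ^ ((d : ℝ) + a) / β' / ((n : ℝ) ^ d * ((n : ℝ) / d) ^ d) :=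
      (le_div_iff₀' hnd).2 h7
    refine h8.trans (le_of_eq ?_)
    have e1 : (n : ℝ) ^ ((d : ℝ) + a) = (n : ℝ) ^ d * (n : ℝ) ^ a := by
      rw [Real.rpow_add hn0, Real.rpow_natCast]
    have e2 : (n : ℝ) ^ ((d : ℝ) - a) * (n : ℝ) ^ a = (n : ℝ) ^ d := by
      rw [← Real.rpow_add hn0, sub_add_cancel, Real.rpow_natCast]
    have hna : (n : ℝ) ^ a ≠ 0 := (Real.rpow_pos_of_pos hn0 _).ne'
    have hnda : (n : ℝ) ^ ((d : ℝ) - a) ≠ 0 := (Real.rpow_pos_of_pos hn0 _).ne'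
    rw [hCdef, e1, div_pow]
    field_simp
    linear_combination e2
  -- `β < β_c` or `β = β_c` (left-continuity)
  rcases hββc.lt_or_eq with hlt | heq
  · exact hsub β hβ hlt
  · have hβc : 0 < LongRangeIsing.criticalBeta J := hβ.trans_le hββc
    rw [heq]
    have hlim := tendsto_pairCorrelation_nhdsLT J hJnn hβc (0 : Site d) x
    have hR : Tendsto (fun β' : ℝ => C / (β' * (n : ℝ) ^ ((d : ℝ) - a))) (𝓝[<] LongRangeIsing.criticalBeta J)
        (𝓝 (C / (LongRangeIsing.criticalBeta J * (n : ℝ) ^ ((d : ℝ) - a)))) := by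
      refine (ContinuousAt.tendsto ?_).mono_left nhdsWithin_le_nhds
      refine continuousAt_const.div (continuousAt_id.mul continuousAt_const) ?_
      exact mul_ne_zero hβc.ne' (Real.rpow_pos_of_pos hn0 _).ne'
    refine le_of_tendsto_of_tendsto hlim hR ?_
    filter_upwards [Ioo_mem_nhdsLT hβc] with β' hβ'
    exact hsub β' hβ'.1 hβ'.2

/-- **DISCHARGE of the named fact `panis_infraredBound_algebraic`** (Panis 2023, §3.6, the infrared
bound for the algebraically decaying reflection-positive couplings `J_{x,y} = C₀|x-y|₁^{-d-α}`, `d ≥ 3`,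
`α ≠ 2`, `0 < β ≤ β_c`): from `panis_infraredBound_algebraic_beta_holds` by monotonicity in `β`
(`panis_infraredBound_algebraic_of_beta`). [cite: Panis2023Triviality, §3.6 (last display of p. 16) with Proposition 3.8 and Remark 3.9] -/
theorem panis_infraredBound_algebraic_holds : panis_infraredBound_algebraic :=
  panis_infraredBound_algebraic_of_beta panis_infraredBound_algebraic_beta_holds

end Literature.Barriers.CriticalPhenomena
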